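import Literature.Topology.FourManifolds.TautFoliationsTameFunctions
import Mathlib.Topology.Compactness.Compact
import Mathlib.Data.Finset.Sort
import HarnessLib

/-!
# Tame real functions: finite partitions into monotone pieces

Sibling of `TautFoliationsTameFunctions.lean` (one-sided tameness `IsTameRight`/`IsTameLeft`,
tameness `IsTameOn f a b` on an interval, tame approximation). This file passes from the
*local* definition to the *global* normal form: a function tame on `[a, b]` admits a finite
partition `a = s₀ < s₁ < ⋯ < sₙ = b` on each closed piece of which it is strictly increasing,
strictly decreasing or constant (`IsTameOn.exists_partition`) — the one-variable `C⁰`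
counterpart of "a Morse function on a compact interval has finitely many critical points and
is monotone between consecutive ones" (Camacho–Lins Neto, *Geometric Theory of Foliations*,
Ch. VI §2). The proof is a compactness argument: finitely many two-sided tameness intervals
cover `[a, b]`, and between two consecutive points of the finite set of their centres and end
points the function lies inside a single one-sided piece.

* `TameFunction.IsPiece f p p'` (**definition**): on `[p, p']`, `f` is strictly increasing,
  strictly decreasing, or constant; pieces restrict (`IsPiece.mono`).
* `TameFunction.IsTameOn.exists_partition` (**proved**): the finite partition into pieces,
  as a strictly increasing `s : Fin (n + 1) → ℝ` with `s 0 = a`, `s (Fin.last n) = b`.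

## References

* C. Camacho, A. Lins Neto, *Geometric Theory of Foliations*, Birkhäuser (1985), Ch. VI §2
  [CamachoLinsNeto1985].

## Design notes

* Pure real analysis (Mathlib only, through the sibling). The partition is produced from a
  finite set of reals by `Finset.orderEmbOfFin`.
-/
open Set Filter Topology

namespace Literature.Topology.FourManifolds

namespace TameFunction

variable {f : ℝ → ℝ} {a b p p' x : ℝ}

-- BODY
/-! ## Pieces -/

/-- `f` is a **piece** on `[p, p']`: strictly increasing, strictly decreasing or constant there.
[folklore] -/
def IsPiece (f : ℝ → ℝ) (p p' : ℝ) : Prop :=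
  StrictMonoOn f (Icc p p') ∨ StrictAntiOn f (Icc p p') ∨ ∀ y ∈ Icc p p', ∀ y' ∈ Icc p p', f y = f y'

/-- Pieces restrict to subintervals. [folklore] -/
theorem IsPiece.mono (h : IsPiece f p p') {q q' : ℝ} (hq : p ≤ q) (hq' : q' ≤ p') : IsPiece f q q' := by
  have hsub : Icc q q' ⊆ Icc p p' := Icc_subset_Icc hq hq'
  rcases h with h | h | h
  · exact Or.inl (h.mono hsub)
  · exact Or.inr (Or.inl (h.mono hsub))
  · exact Or.inr (Or.inr fun y hy y' hy' ↦ h y (hsub hy) y' (hsub hy'))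

/-- A right tameness interval is a piece. [folklore] -/
theorem isPiece_of_right {δ : ℝ}
    (h : StrictMonoOn f (Icc x (x + δ)) ∨ StrictAntiOn f (Icc x (x + δ)) ∨ ∀ y ∈ Icc x (x + δ), f y = f x) :
    IsPiece f x (x + δ) := by
  rcases h with h | h | h
  · exact Or.inl h
  · exact Or.inr (Or.inl h)
  · exact Or.inr (Or.inr fun y hy y' hy' ↦ by rw [h y hy, h y' hy'])

/-- A left tameness interval is a piece. [folklore] -/
theorem isPiece_of_left {δ : ℝ}
    (h : StrictMonoOn f (Icc (x - δ) x) ∨ StrictAntiOn f (Icc (x - δ) x) ∨ ∀ y ∈ Icc (x - δ) x, f y = f x) :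
    IsPiece f (x - δ) x := by
  rcases h with h | h | h
  · exact Or.inl h
  · exact Or.inr (Or.inl h)
  · exact Or.inr (Or.inr fun y hy y' hy' ↦ by rw [h y hy, h y' hy'])

/-! ## Two-sided tameness intervals -/

/-- **Two-sided tameness intervals**: every point of `[a, b]` is the centre of an interval
`[x - δ, x + δ]`, `δ > 0`, whose two halves (clipped to `[a, b]`) are pieces of a function tame
on `[a, b]`. At the end points the outer half is irrelevant; for a uniform statement the
function is regarded through its pieces inside `[a, b]` only. [folklore] -/
theorem IsTameOn.exists_two_sided (hf : IsTameOn f a b) (hab : a < b) (hx : x ∈ Icc a b) :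
    ∃ δ > (0 : ℝ), IsPiece f (max a (x - δ)) x ∧ IsPiece f x (min b (x + δ)) := by
  obtain ⟨hxa, hxb⟩ := hx
  -- right piece (or a degenerate one at `x = b`)
  have hR : ∃ δ > (0 : ℝ), IsPiece f x (min b (x + δ)) := by
    rcases hxb.lt_or_eq with hxb' | rfl
    · obtain ⟨δ, hδ, h⟩ := hf.2.1 x ⟨hxa, hxb'⟩
      refine ⟨δ, hδ, (isPiece_of_right h).mono le_rfl (min_le_right _ _)⟩
    · refine ⟨1, one_pos, ?_⟩
      rw [min_eq_left (by linarith)]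
      exact Or.inr (Or.inr fun y hy y' hy' ↦ by
        rw [le_antisymm hy.2 hy.1, le_antisymm hy'.2 hy'.1])
  -- left piece (or a degenerate one at `x = a`)
  have hL : ∃ δ > (0 : ℝ), IsPiece f (max a (x - δ)) x := by
    rcases hxa.lt_or_eq with hxa' | rfl
    · obtain ⟨δ, hδ, h⟩ := hf.2.2 x ⟨hxa', hxb⟩
      refine ⟨δ, hδ, (isPiece_of_left h).mono (le_max_right _ _) le_rfl⟩
    · refine ⟨1, one_pos, ?_⟩
      rw [max_eq_left (by linarith)]
      exact Or.inr (Or.inr fun y hy y' hy' ↦ by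
        rw [le_antisymm hy.2 hy.1, le_antisymm hy'.2 hy'.1])
  obtain ⟨δ₁, hδ₁, h₁⟩ := hR
  obtain ⟨δ₂, hδ₂, h₂⟩ := hL
  refine ⟨min δ₁ δ₂, lt_min hδ₁ hδ₂, h₂.mono ?_ le_rfl, h₁.mono le_rfl ?_⟩
  · exact max_le_max le_rfl (by linarith [min_le_right δ₁ δ₂])
  · exact min_le_min le_rfl (by linarith [min_le_left δ₁ δ₂])

/-! ## The finite partition -/

/-- **A tame function has a finite partition into pieces.** If `f` is tame on `[a, b]`,
`a < b`, there are `n` and a strictly increasing `s : Fin (n + 1) → ℝ` with `s 0 = a`,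
`s (Fin.last n) = b`, such that `f` is a piece (strictly increasing, strictly decreasing or
constant) on each `[s i, s (i + 1)]`. [cite: CamachoLinsNeto1985, Ch. VI §2] -/
theorem IsTameOn.exists_partition (hf : IsTameOn f a b) (hab : a < b) :
    ∃ (n : ℕ) (s : Fin (n + 1) → ℝ), StrictMono s ∧ s 0 = a ∧ s (Fin.last n) = b ∧
      ∀ i : Fin n, IsPiece f (s (Fin.castSucc i)) (s i.succ) := by
  classical
  -- two-sided tameness intervals around every point, and a finite subcover of `[a, b]`
  choose! δ hδ hpiece using fun x (hx : x ∈ Icc a b) ↦ hf.exists_two_sided hab hx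
  obtain ⟨T, hTsub, hTcov⟩ := isCompact_Icc.elim_nhds_subcover (fun x ↦ Ioo (x - δ x) (x + δ x))
    fun x hx ↦ Ioo_mem_nhds (by linarith [hδ x hx]) (by linarith [hδ x hx])
  -- the finite set of partition points
  let P : Finset ℝ := insert a (insert b ((T ∪ (T.image fun x ↦ max a (x - δ x)) ∪
    T.image fun x ↦ min b (x + δ x)).filter fun y ↦ a ≤ y ∧ y ≤ b))
  have hPa : a ∈ P := Finset.mem_insert_self _ _
  have hPb : b ∈ P := Finset.mem_insert_of_mem (Finset.mem_insert_self _ _)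
  have hPsub : ∀ y ∈ P, a ≤ y ∧ y ≤ b := by
    intro y hy
    rcases Finset.mem_insert.1 hy with rfl | hy
    · exact ⟨le_rfl, hab.le⟩
    rcases Finset.mem_insert.1 hy with rfl | hy
    · exact ⟨hab.le, le_rfl⟩
    exact (Finset.mem_filter.1 hy).2
  have hPT : ∀ x ∈ T, x ∈ P := fun x hx ↦
    Finset.mem_insert_of_mem (Finset.mem_insert_of_mem (Finset.mem_filter.2
      ⟨Finset.mem_union_left _ (Finset.mem_union_left _ hx), hTsub x hx⟩))
  have hPL : ∀ x ∈ T, max a (x - δ x) ∈ P := fun x hx ↦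
    Finset.mem_insert_of_mem (Finset.mem_insert_of_mem (Finset.mem_filter.2
      ⟨Finset.mem_union_left _ (Finset.mem_union_right _ (Finset.mem_image_of_mem _ hx)),
        le_max_left _ _, max_le hab.le (by linarith [hδ x (hTsub x hx), (hTsub x hx).2])⟩))
  have hPR : ∀ x ∈ T, min b (x + δ x) ∈ P := fun x hx ↦
    Finset.mem_insert_of_mem (Finset.mem_insert_of_mem (Finset.mem_filter.2
      ⟨Finset.mem_union_right _ (Finset.mem_image_of_mem _ hx),
        le_min hab.le (by linarith [hδ x (hTsub x hx), (hTsub x hx).1]), min_le_left _ _⟩))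
  -- sort the partition points
  have hcard : 0 < P.card := Finset.card_pos.2 ⟨a, hPa⟩
  obtain ⟨n, hn⟩ : ∃ n, P.card = n + 1 := ⟨P.card - 1, (Nat.succ_pred_eq_of_pos hcard).symm⟩
  let e : Fin (n + 1) ↪o ℝ := P.orderEmbOfFin hn
  have hes : ∀ i, e i ∈ P := fun i ↦ P.orderEmbOfFin_mem hn i
  have herange : ∀ y ∈ P, ∃ i, e i = y := fun y hy ↦ by
    have : y ∈ Set.range e := by rw [Finset.range_orderEmbOfFin]; exact hy
    exact this
  refine ⟨n, e, e.strictMono, ?_, ?_, fun i ↦ ?_⟩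
  · -- the least element is `a`
    apply le_antisymm
    · obtain ⟨i, hi⟩ := herange a hPa
      rw [← hi]
      exact e.monotone (Fin.zero_le i)
    · exact (hPsub _ (hes 0)).1
  · -- the greatest element is `b`
    apply le_antisymm
    · exact (hPsub _ (hes _)).2
    · obtain ⟨i, hi⟩ := herange b hPb
      rw [← hi]
      exact e.monotone (Fin.le_last i)
  · -- between two consecutive points the function is inside one piece
    set p := e (Fin.castSucc i) with hp
    set p' := e i.succ with hp'
    have hpp' : p < p' := e.strictMono (Fin.castSucc_lt_succ (i := i))
    have hnone : ∀ y ∈ P, ¬ (p < y ∧ y < p') := by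
      rintro y hy ⟨h₁, h₂⟩
      obtain ⟨j, rfl⟩ := herange y hy
      have hj₁ : Fin.castSucc i < j := e.lt_iff_lt.1 h₁
      have hj₂ : j < i.succ := e.lt_iff_lt.1 h₂
      rw [Fin.lt_def] at hj₁ hj₂
      simp only [Fin.val_castSucc, Fin.val_succ] at hj₁ hj₂
      omega
    have hpP : p ∈ P := hes _
    have hp'P : p' ∈ P := hes _
    obtain ⟨hap, hpb⟩ := hPsub p hpP
    obtain ⟨hap', hp'b⟩ := hPsub p' hp'P
    -- the midpoint lies in one of the covering intervals
    have hm : (p + p') / 2 ∈ Icc a b := ⟨by linarith, by linarith⟩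
    obtain ⟨x, hxT, hxm⟩ := mem_iUnion₂.1 (hTcov hm)
    obtain ⟨hxm₁, hxm₂⟩ := hxm
    have hxab : x ∈ Icc a b := hTsub x hxT
    obtain ⟨hLp, hRp⟩ := hpiece x hxab
    rcases le_or_gt x p with hxp | hxp
    · -- `x ≤ p`: `[p, p']` lies in the right piece of `x`
      have hmin : p' ≤ min b (x + δ x) := by
        by_contra hlt
        push Not at hlt
        exact hnone _ (hPR x hxT) ⟨lt_min (by linarith) (by linarith), hlt⟩
      exact hRp.mono hxp hmin
    · -- `x > p`, hence `x ≥ p'`: `[p, p']` lies in the left piece of `x`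
      have hxp' : p' ≤ x := by
        by_contra hlt
        push Not at hlt
        exact hnone x (hPT x hxT) ⟨hxp, hlt⟩
      have hmax : max a (x - δ x) ≤ p := by
        by_contra hlt
        push Not at hlt
        exact hnone _ (hPL x hxT) ⟨hlt, max_lt (by linarith) (by linarith)⟩
      exact hLp.mono hmax hxp'

end TameFunction

end Literature.Topology.FourManifolds
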